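import Summits.Langlands.Langlands.Theses.OrdinaryPrimeTransport
import Literature.NumberTheory.Automorphic.RamakrishnanAsaiTransferGL2   -- p204438 (this unit, ACCEPTED, commit 44f35a98b6b8)
import HarnessLib

/-!
# Line `AsaiGL3` — ladder rung g26 under crux stmt-Langlands-14328 (`ReciprocityUpToIrreducibility`, "E")

Forward generator G4 (ladder-down), dial θ26 = **the rank `N` of the ASAI (twisted tensor induction) sector**:
`As_{E/F} : ᴸ(Res_{E/F} GL_N) → GL_{N²}` for a quadratic extension `E/F` — the one basic functorial operation on
general linear groups (base change g16/g20, automorphic induction g19/g23, Rankin–Selberg product g5/g25, symmetric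
powers g7, exterior square g14, **Asai —**) not used by the rungs g1–g25 nor by any open route of the summit.

* FAMILY `AsaiReciprocity N` — clause (B) of the summit (Galois ⇒ automorphic) over EVERY number field `F`, every
  quadratic `E/F`, every `ℓ`, `ι`, in the a.e.-Satake form of the house (g23/g25): for irreducible
  `ρ : Γ_F → GL_{N²}(ℚ̄_ℓ)` de Rham above `ℓ` whose Frobenius characteristic polynomials at almost all places are the
  `ι`-transports of the unramified ASAI polynomials `det(1 - As(t_v) T)` (tree: `asaiLocalPolynomial c A 1 w`,
  `AsaiSign`) of an Asai datum `(S, A)` of a CUSPIDAL `Π` on `GL_N(𝔸_E)` — the unramified shadow of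
  "`ρ ≅ As_{E/F}(ρ_Π)`", stated without assuming `Π` has a Galois representation — there is an automorphic `P` on
  `GL_{N²}(𝔸_F)` with `SatakeFrobCompatibleAt ι P ρ v` for almost all `v`.
* FLOOR θ₀ = 2 (`floor_two`, PROVED modulo the named fact `Ramakrishnan2002_asaiTransfer_GL2 := WeakAsaiFunctoriality 2`,
  Ramakrishnan 2002 Thm. D (a) / Krishnamurthy 2003, vendored by this unit as
  `Literature/NumberTheory/Automorphic/RamakrishnanAsaiTransferGL2.lean`, p204438 ACCEPTED, commit 44f35a98b6b8, used BY NAME).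
* RUNG θ = 3: `AsaiGL3 := AsaiReciprocity 3` (`GL₃/E → GL₉/F`), OPEN: the Langlands–Shahidi list offers
  `L(s, As(Π) × τ)` only for `τ` on `GL_m(𝔸_F)`, `m ≤ 2` (`²A₅ ⊃ Res GL₃`, `²E₆ ⊃ Res GL₃ × GL₂`, the quasi-split twist
  of the `E₆`-Levi `GL₃ × GL₃ × GL₂` behind g25's stop), while the `GL₉` converse theorem needs `m ≤ 7`; and the
  base-change détour (`ρ|_{Γ_E}` is of `GL₃ ⊠ GL₃`-type over `E`) meets BOTH the open `(3,3)` Rankin–Selberg product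
  AND the inert-place sign ambiguity of quadratic descent (Ramakrishnan 2002, p. 3: "it is not at all clear that `Π`,
  or `Π ⊗ δ`, should correspond precisely to `As(σ)`").

Registered stubs (sorries ONLY here): `stub_floorFact` (the print floor as a text), `stub_rung` (THE RUNG),
`stub_higherRanks` (`N ≥ 4`), `stub_sectorMerge` (a.e. Satake on the whole Asai sector ⇒ clause (B) verbatim on
the sector, every `Rec`), `stub_offSector` (E off the Asai sector — the honest complement).  Composition
`ReciprocityUpToIrreducibility_of` concludes the crux BY NAME (the `Iff.rfl`-equal shared decl
`…Theses.OrdinaryPrimeTransport.ReciprocityUpToIrreducibility` of item stmt-Langlands-14328).  Sorry-free: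
`of_weakAsaiFunctoriality`, `floor_two` (F3), `family_of`, `AsaiGL3_of_top`, `asaiReciprocity_of_langlands` (F4).
-/

noncomputable section

set_option linter.dupNamespace false

open scoped MatrixGroups Matrix NumberField Classical Polynomial
open Filter IsDedekindDomain Field Polynomial NumberField
open Literature.NumberTheory.Automorphic Literature.NumberTheory.GaloisRepresentations
open Literature.NumberTheory.PAdicHodge
open Summit.Langlands

namespace Summit.Langlands.Langlands.Cruxes.ReciprocityUpToIrreducibility.AsaiGL3

/-! ## 1. The graded family (dial = the rank `N` on the `E`-side, target rank `N * N`) and the rung `N = 3` -/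

/-- **The rung family** `AsaiReciprocity N`: clause (B) of the summit over EVERY number field `F`, every quadratic
extension `E/F` (non-trivial automorphism `c`), every `ℓ` and `ι : ℚ̄_ℓ ≃ ℂ`, in the a.e.-Satake form, for
irreducible `ρ : Γ_F → GL_{N²}(ℚ̄_ℓ)` de Rham above `ℓ` (pinned Fontaine datum `fontainePstAdicCompletion`) which, at
all but finitely many places `v`, are unramified with Frobenius characteristic polynomial the `ι`-Satake polynomial
of every multiset `γ` whose Euler polynomial `∏ (1 - γ_k T)` is the unramified Asai polynomial
`asaiLocalPolynomial c A 1 w = det(1 - As(t_v) T)` (at split `v = w w̄`: `det(1 - t_w ⊗ t_{w̄} T)`; at inert `v`: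
`∏_i (1 - a_i T) ∏_{i<j} (1 - a_i a_j T²)`) of a Satake family `A` that is an Asai datum (for SOME finite exceptional set `S`) of a CUSPIDAL `Π` on
`GL_N(𝔸_E)` — the unramified shadow of "`ρ ≅ As_{E/F}(ρ_Π)`".  Conclusion: an AUTOMORPHIC `P` on `GL_{N²}(𝔸_F)` (Borel–Jacquet
datum, not asserted cuspidal) with `SatakeFrobCompatibleAt ι P ρ v` for almost all `v`.  Implied by the summit and
by E for every `N ≥ 1` (`…_of_langlands`, `…_of_top`); implied by `WeakAsaiFunctoriality N`
(`of_weakAsaiFunctoriality`), hence PROVED at `N = 2` modulo the named fact; OPEN at `N = 3` (`GL₃/E → GL₉/F`). -/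
def AsaiReciprocity (N : ℕ) : Prop :=
  ∀ (F E : Type) [Field F] [NumberField F] [Field E] [NumberField E] [Algebra F E],
    Module.finrank F E = 2 → ∀ c : E ≃ₐ[F] E, c ≠ 1 →
    ∀ (hE : isCompact_glFiniteIntegralLevel N E) (piE : CuspidalAutomorphicRepData N E hE)
      (A : SatakeFamily E), (∃ S : Set (HeightOneSpectrum (𝓞 F)), piE.1.IsAsaiDatum c S A) →
    ∀ (ℓ : ℕ) [Fact ℓ.Prime] (ι : PadicAlgCl ℓ ≃+* ℂ) (ρ : FramedGaloisRep F (PadicAlgCl ℓ) (N * N)),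
      ρ.toGaloisRep.IsIrreducible →
      (∀ (v : HeightOneSpectrum (𝓞 F)) (hv : ((ℓ : ℕ) : 𝓞 F) ∈ v.asIdeal),
          (fontainePstAdicCompletion v ℓ hv).IsDeRhamFramed (ρ.toLocal v)) →
      (∀ᶠ v : HeightOneSpectrum (𝓞 F) in cofinite, ρ.IsUnramifiedAt v ∧
          ∀ w : HeightOneSpectrum (𝓞 E), w.under (𝓞 F) = v →
            ∀ γ : Multiset ℂ, eulerPolynomial γ = asaiLocalPolynomial c A 1 w →
              ρ.HasFrobCharpolyAt v (arithFrobPolyOfSatake ι v.residueCard 1 γ)) →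
      ∀ hF : isCompact_glFiniteIntegralLevel (N * N) F,
        ∃ P : AutomorphicRepData (AutomorphyDatum.gl (N * N) F hF),
          ∀ᶠ v : HeightOneSpectrum (𝓞 F) in cofinite, SatakeFrobCompatibleAt ι P ρ v

/-- **THE RUNG** (the filed statement): the family at `N = 3` — clause (B) for irreducible de Rham
`GL₉`-representations of Asai type `As_{E/F}(GL₃)` over every number field and every quadratic `E/F`. -/
-- @[stub "AsaiGL3"]
def AsaiGL3 : Prop := AsaiReciprocity 3

/-- The floor cell `N = 2` of the family as a decl (decided modulo the named fact, `floor_two`). -/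
def AsaiGL2 : Prop := AsaiReciprocity 2

/-! ## 2. Weak Asai functoriality at `N` gives the rung family at `N` -/

/-- **`WeakAsaiFunctoriality N → AsaiReciprocity N`**: the automorphic a.e. Asai lift `P` of `(c, A)` has, at almost
every `v`, a Satake parameter `γ` with Euler polynomial the Asai polynomial above `v`, which is what the sector clause
says `ρ(Frob_v)` has as inverse-root data (a place `w ∣ v` exists: accepted `HeightOneSpectrum.exists_under_eq`).
[folklore] -/
theorem of_weakAsaiFunctoriality {N : ℕ} (h : WeakAsaiFunctoriality N) : AsaiReciprocity N := by
  intro F E _ _ _ _ _ h2 c hc hE piE A hSA ℓ _ ι ρ _hirr _hdR hsec hF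
  obtain ⟨S, hdat⟩ := hSA
  obtain ⟨P, hP⟩ := h F E h2 c hc hE piE S A hdat hF
  refine ⟨P, ?_⟩
  have hP' : ∀ᶠ v : HeightOneSpectrum (𝓞 F) in cofinite, ∀ w : HeightOneSpectrum (𝓞 E), w.under (𝓞 F) = v →
      ∃ γ : Multiset ℂ, P.HasSatakeParamAt v γ ∧ eulerPolynomial γ = asaiLocalPolynomial c A 1 w := hP
  filter_upwards [hsec, hP'] with v hv hPv
  obtain ⟨hur, hcp⟩ := hv
  obtain ⟨w, hw⟩ := HeightOneSpectrum.exists_under_eq E v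
  obtain ⟨γ, hγP, hγ⟩ := hPv w hw
  exact ⟨γ, hγP, hur, hcp w hw γ hγ⟩

/-! ## 3. The floor cell `N = 2` (Ramakrishnan 2002 Thm. D (a), named fact) -/

/-- **THE FLOOR `N = 2` (PROVED modulo the named fact)**: clause (B) for irreducible de Rham
`ρ : Γ_F → GL₄(ℚ̄_ℓ)` of Asai type `As_{E/F}(GL₂)`, over every number field and every quadratic `E/F` — THE WITNESS
one step below the rung. [cite: Ramakrishnan2002, Theorem D (a)] -/
theorem floor_two (h : Ramakrishnan2002_asaiTransfer_GL2) : AsaiReciprocity 2 :=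
  of_weakAsaiFunctoriality h

/-- F3 special-case instance at the floor cell `N = 2`. -/
example (h : Ramakrishnan2002_asaiTransfer_GL2) : AsaiGL2 := floor_two h

/-! ## 4. The sector, its merge target and the off-sector complement -/

/-- **The Asai sector of clause (B)**: `ρ : Γ_F → GL_n(ℚ̄_ℓ)` is of Asai type — `n = N²` for some `N ≥ 2` and there
are a quadratic `E/F` with non-trivial automorphism `c`, a cuspidal `Π` on `GL_N(𝔸_E)` and an Asai datum `(S, A)`
of `Π` such that, at almost every place, `ρ` is unramified with Frobenius characteristic polynomial the `ι`-Satake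
polynomial of the Asai class above `v`. -/
def InAsaiSector (F : Type) [Field F] [NumberField F] (ℓ : ℕ) [Fact ℓ.Prime] (ι : PadicAlgCl ℓ ≃+* ℂ)
    {n : ℕ} (ρ : FramedGaloisRep F (PadicAlgCl ℓ) n) : Prop :=
  ∃ (E : Type) (_ : Field E) (_ : NumberField E) (_ : Algebra F E) (c : E ≃ₐ[F] E) (N : ℕ)
    (hE : isCompact_glFiniteIntegralLevel N E) (piE : CuspidalAutomorphicRepData N E hE)
    (S : Set (HeightOneSpectrum (𝓞 F))) (A : SatakeFamily E),
    Module.finrank F E = 2 ∧ c ≠ 1 ∧ 2 ≤ N ∧ n = N * N ∧ piE.1.IsAsaiDatum c S A ∧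
    ∀ᶠ v : HeightOneSpectrum (𝓞 F) in cofinite, ρ.IsUnramifiedAt v ∧
      ∀ w : HeightOneSpectrum (𝓞 E), w.under (𝓞 F) = v →
        ∀ γ : Multiset ℂ, eulerPolynomial γ = asaiLocalPolynomial c A 1 w →
          ρ.HasFrobCharpolyAt v (arithFrobPolyOfSatake ι v.residueCard 1 γ)

/-- **Merge target**: clause (B) of E VERBATIM (cuspidal, L-algebraic, `Corresponds Rec ι π ρ` — a.e. Satake AND
`LocalGlobalCompatibleAt` at every finite place) for EVERY reciprocity datum `Rec`, on the Asai sector. -/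
def SectorGaloisToAutomorphic : Prop :=
  ∀ (F : Type) [Field F] [NumberField F] (Rec : ReciprocityData F) (n : ℕ), 0 < n →
    ∀ (hcpt : isCompact_glFiniteIntegralLevel n F) (ℓ : ℕ) [Fact ℓ.Prime] (ι : PadicAlgCl ℓ ≃+* ℂ)
      (ρ : FramedGaloisRep F (PadicAlgCl ℓ) n),
      ρ.toGaloisRep.IsIrreducible → IsGeometricFramed Rec ρ → InAsaiSector F ℓ ι ρ →
        ∃ π : CuspidalAutomorphicRepData n F hcpt, π.1.IsLAlgebraic ∧ Corresponds Rec ι π.1 ρ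

/-- **The off-sector complement**: E (`ReciprocityUpToIrreducibility`) with clause (A) entire and clause (B)
restricted to `ρ` NOT in the Asai sector. -/
-- @[stub "AsaiGL3"]
def OffSectorReciprocity : Prop :=
  ∀ (F : Type) [Field F] [NumberField F], ∃ Rec : ReciprocityData F, ∀ n : ℕ, 0 < n →
    ∀ hcpt : isCompact_glFiniteIntegralLevel n F,
      (∀ π : CuspidalAutomorphicRepData n F hcpt, π.1.IsLAlgebraic →
        ∀ (ℓ : ℕ) [Fact ℓ.Prime] (ι : PadicAlgCl ℓ ≃+* ℂ),
          ∃ ρ : FramedGaloisRep F (PadicAlgCl ℓ) n, IsGeometricFramed Rec ρ ∧ Corresponds Rec ι π.1 ρ) ∧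
      (∀ (ℓ : ℕ) [Fact ℓ.Prime] (ι : PadicAlgCl ℓ ≃+* ℂ) (ρ : FramedGaloisRep F (PadicAlgCl ℓ) n),
        ρ.toGaloisRep.IsIrreducible → IsGeometricFramed Rec ρ → ¬ InAsaiSector F ℓ ι ρ →
          ∃ π : CuspidalAutomorphicRepData n F hcpt, π.1.IsLAlgebraic ∧ Corresponds Rec ι π.1 ρ)

/-- **The higher rungs** of the graded family: `N ≥ 4` (`GL₄/E → GL₁₆/F`, …; all open). -/
-- @[stub "AsaiGL3"]
def HigherRanks : Prop := ∀ N : ℕ, 4 ≤ N → AsaiReciprocity N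

/-- **The floor as a text** — the in-tree named fact `Ramakrishnan2002_asaiTransfer_GL2` (Ramakrishnan 2002
Thm. D (a): weak Asai functoriality at rank 2), given a local name so that it is an obligation node of the
composition `ReciprocityUpToIrreducibility_of` (cf. g25 `WeakTensorTexts`).  The five obligation nodes `FloorText`, `AsaiGL3`,
`HigherRanks`, `SectorMergeStep`, `OffSectorReciprocity` carry `@[stub "AsaiGL3"]` in the seat's REGISTRATION copy only
(crux workfiles do not carry gate-reserved attributes; here the tag lines are comments). -/
-- @[stub "AsaiGL3"]
def FloorText : Prop := Ramakrishnan2002_asaiTransfer_GL2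

/-- **The sector-merge step** — a.e. Satake–Frobenius compatibility with an automorphic `P` on the whole Asai
sector (all ranks `N ≥ 2`) upgrades to clause (B) verbatim there (cuspidal `L`-algebraic `π`, full `Corresponds`,
for EVERY reciprocity datum `Rec`).  Named so that it is an obligation node of the composition. -/
-- @[stub "AsaiGL3"]
def SectorMergeStep : Prop := (∀ N : ℕ, 2 ≤ N → AsaiReciprocity N) → SectorGaloisToAutomorphic

/-! ## 5. The five registered stubs -/

/-- Floor cell `N = 2` — a theorem in print (Ramakrishnan 2002 Thm. D (a); Krishnamurthy 2003), vendored as the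
named fact `Ramakrishnan2002_asaiTransfer_GL2` (p204438); XL to discharge in the tree (Langlands–Shahidi for
`²D₄ ⊃ Res_{E/F} GL₂ × GL₂` + the `GL₄` converse theorem). [cite: Ramakrishnan2002, Theorem D (a)] -/
theorem stub_floorFact : FloorText := by
  sorry

/-- **THE RUNG** `N = 3`: clause (B), a.e.-Satake form, for irreducible de Rham `ρ : Γ_F → GL₉(ℚ̄_ℓ)` of Asai type
`As_{E/F}(GL₃)` over every number field.  OPEN (Langlands–Shahidi + converse theorem stop at `N = 2`: the `GL₉`
converse theorem needs twists by `GL_m`, `m ≤ 7`; `L(s, As(Π) × τ)` is on the Langlands–Shahidi list only for `τ`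
on `GL_m`, `m ≤ 2` — `²E₆ ⊃ Res_{E/F} GL₃ × GL₂`; the base-change détour meets the open `(3,3)` product over `E`
and the inert-place sign ambiguity of quadratic descent). -/
theorem stub_rung : AsaiGL3 := by
  sorry

/-- The cells `N ≥ 4` of the family (open). -/
theorem stub_higherRanks : HigherRanks := by
  sorry

/-- Sector merge: from a.e.-Satake automorphy on the whole Asai sector (all `N ≥ 2`) to clause (B) of E verbatim on
the sector, for every `Rec` (isobaric rigidity ⇒ the automorphic `P` attached to the IRREDUCIBLE `ρ` may be taken
cuspidal; L-algebraicity from the Hodge–Tate weights; local–global compatibility at every finite place, the `v ∣ ℓ`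
clause against the pinned Fontaine datum). -/
theorem stub_sectorMerge : SectorMergeStep := by
  sorry

/-- The honest complement: E off the Asai sector. -/
theorem stub_offSector : OffSectorReciprocity := by
  sorry

/-! ## 6. Composition (no sorry below this line) -/

/-- The whole graded family (`N ≥ 2`) from the floor text, the rung and the higher rungs. -/
theorem family_of (h2 : FloorText) (h3 : AsaiGL3) (hhi : HigherRanks)
    (N : ℕ) (hN : 2 ≤ N) : AsaiReciprocity N := by
  by_cases h4 : 4 ≤ N
  · exact hhi N h4
  · interval_cases N
    · exact floor_two h2
    · exact h3

/-- **SKELETON THEOREM — the crux BY NAME from the five REGISTERED stubs, used by name** (audit: proof-of-item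
modulo the five sorries; this is the theorem `ledger skeleton check` registers).  `Rec` and clause (A) come from the
off-sector stub; clause (B) is a case split on the Asai sector. -/
theorem reciprocityUpToIrreducibility_of_stubs :
    Summit.Langlands.Langlands.Theses.OrdinaryPrimeTransport.ReciprocityUpToIrreducibility := by
  intro F _ _
  obtain ⟨Rec, hall⟩ := stub_offSector F
  refine ⟨Rec, fun n hn hcpt => ⟨(hall n hn hcpt).1, ?_⟩⟩
  intro ℓ _ ι ρ hirr hgeo
  by_cases hsec : InAsaiSector F ℓ ι ρ
  · exact stub_sectorMerge (family_of stub_floorFact stub_rung stub_higherRanks) F Rec n hn hcpt ℓ ι ρ hirr hgeo hsec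
  · exact (hall n hn hcpt).2 ℓ ι ρ hirr hgeo hsec

/-- **COMPOSITION, hypothesis form — the crux BY NAME from the five stub STATEMENTS** (sorry-free; the same
eight lines with the stubs as hypotheses, for provers who close the stubs elsewhere). -/
theorem ReciprocityUpToIrreducibility_of :
    FloorText → AsaiGL3 → HigherRanks → SectorMergeStep → OffSectorReciprocity →
    Summit.Langlands.Langlands.Theses.OrdinaryPrimeTransport.ReciprocityUpToIrreducibility := by
  intro h2 h3 hhi hmerge hoff F _ _
  obtain ⟨Rec, hall⟩ := hoff F
  refine ⟨Rec, fun n hn hcpt => ⟨(hall n hn hcpt).1, ?_⟩⟩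
  intro ℓ _ ι ρ hirr hgeo
  by_cases hsec : InAsaiSector F ℓ ι ρ
  · exact hmerge (family_of h2 h3 hhi) F Rec n hn hcpt ℓ ι ρ hirr hgeo hsec
  · exact (hall n hn hcpt).2 ℓ ι ρ hirr hgeo hsec

/-! ## 7. The rung is a consequence of the top and of the summit (sorry-free) -/

/-- `E → AsaiReciprocity N` for every `N ≥ 1` (clause (B) of E for its own `Rec`: the family's de Rham clause is
against `fontainePstAdicCompletion = Rec.pst` by `rfl`, a.e. unramifiedness is read off the sector clause,
cuspidal ⇒ automorphic, `Corresponds` ⊃ a.e. Satake). -/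
theorem asaiReciprocity_of_top (N : ℕ) (hN : 1 ≤ N)
    (hE : Summit.Langlands.Langlands.Theses.OrdinaryPrimeTransport.ReciprocityUpToIrreducibility) :
    AsaiReciprocity N := by
  intro F E _ _ _ _ _ h2 c hc hEcpt piE A hSA ℓ _ ι ρ hirr hdR hsec hF
  obtain ⟨Rec, hall⟩ := hE F
  have hpos : 0 < N * N := Nat.mul_pos hN hN
  have hB : GaloisToAutomorphic (N * N) Rec hF := (hall (N * N) hpos hF).2
  have hgeo : IsGeometricFramed Rec ρ := ⟨hsec.mono fun v hv => hv.1, fun v hv => hdR v hv⟩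
  obtain ⟨π', -, hcorr⟩ := hB ℓ ι ρ hirr hgeo
  exact ⟨π'.1, hcorr.1⟩

/-- `E → rung`. -/
theorem AsaiGL3_of_top
    (hE : Summit.Langlands.Langlands.Theses.OrdinaryPrimeTransport.ReciprocityUpToIrreducibility) : AsaiGL3 :=
  asaiReciprocity_of_top 3 (by norm_num) hE

/-- **Dial monotonicity in the summit direction**: `Langlands → AsaiReciprocity N` for every `N ≥ 1` — clause (B) at
rank `N²` over `F` for the reciprocity datum the summit provides. -/
theorem asaiReciprocity_of_langlands (N : ℕ) (hN : 1 ≤ N) (hL : _root_.Langlands) : AsaiReciprocity N := by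
  intro F E _ _ _ _ _ h2 c hc hEcpt piE A hSA ℓ _ ι ρ hirr hdR hsec hF
  obtain ⟨⟨Rec⟩, hall⟩ := hL F
  have hpos : 0 < N * N := Nat.mul_pos hN hN
  have hB : GaloisToAutomorphic (N * N) Rec hF := (hall Rec (N * N) hpos hF).2
  have hgeo : IsGeometricFramed Rec ρ := ⟨hsec.mono fun v hv => hv.1, fun v hv => hdR v hv⟩
  obtain ⟨π', -, hcorr⟩ := hB ℓ ι ρ hirr hgeo
  exact ⟨π'.1, hcorr.1⟩

/-- **F4 on-path lemma for the rung**: `Langlands → AsaiGL3`. -/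
@[aesop safe apply]
theorem AsaiGL3_of_Langlands (hL : _root_.Langlands) : AsaiGL3 :=
  asaiReciprocity_of_langlands 3 (by norm_num) hL

end Summit.Langlands.Langlands.Cruxes.ReciprocityUpToIrreducibility.AsaiGL3

end
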